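import Literature.AlgebraicGeometry.Resolution.WeightedCentreInvariantSet
import Literature.AlgebraicGeometry.Resolution.WeightedCentreDelta

/-!
# The first-stage centre `(y^ν, u^{νδ})` is an element of `W(f)`

[ATW24] Abramovich–Temkin–Włodarczyk, Algebra & Number Theory 18 (2024), Def. 2.4.1, Rem. 2.4.2
(p. 1568), §5.1 (p. 1575: `inv_p(I) = max invariant of an admissible centre`, the centre
`J = (x₁^{a₁}, …, x_k^{a_k})` with `a₁ ≤ ⋯ ≤ a_k`); [CJS20] Cossart–Jannsen–Saito, LNM 2270, Def. 8.1 (3),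
Def. 8.2 (1) (pp. 117–118: `δ(f; u; y)`); [AQS25] Abramovich–Quek–Schober, Thm. 3.5 (the invariant
is the lex-maximum over admissible centres — the reading behind `admissibleInvariants`).

This file joins `WeightedCentreInvariantSet` (`W(f) = admissibleInvariants f`, centres
`IsCentreFor f Ψ γ`) and `WeightedCentreDelta` (`hironakaDelta S ν g = δ(g; u; y)`,
`blockWeights S ν c` = the cocharacter of `(y^ν, u^{νc})`).  For `f ∈ k[x₁, …, x_n]`, an origin-fixing
coordinate change `Ψ` and a set `S` of `y`-variables, PROVED:
* `isCentreFor_blockWeights_iff` — `(Ψ; y^ν, u^{νc})` is a centre for `f` iff `c ≤ δ(Ψ⁻¹ f; u; y)`;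
* `exps_blockWeights` — its exponent list is `(ν, …, ν, νc, …, νc)` (`|S|` entries `ν`, for `c ≥ 1`);
* `one_le_hironakaDelta_symm` — `δ(Ψ⁻¹ f; u; y) ≥ 1` when `ν = ord f`;
* `blockShape_mem_admissibleInvariants`, **`firstStage_mem_admissibleInvariants`** — for `ν = ord f`
  and `δ = δ(Ψ⁻¹ f; u; y) < ∞`: **`(ν^{|S|}, (νδ)^{n − |S|}) ∈ W(f)`** (the value the observatory's
  certificate exhibits as attained), and `not_isCentreFor_blockWeights_of_delta_lt` — no `c > δ` in the
  same coordinates and shape;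
* `truncLex_blockShape_lt` — in ATW's order these lists increase with `c`;
* `hironakaTau_le_card_of_isCentreFor_blockWeights`, `directrix_eq_span_of_isCentreFor_blockWeights` —
  a centre `(Ψ; y^ν, u^{νc})` with `c > 1` has `|S| ≥ τ(in_ν f)` `y`-variables, and when `|S| = τ` their
  linear parts cut out the directrix of `in_ν f` (the certificate's normalisation `N₀`, from
  `WeightedCentreInvariantSet.directrix_eq_span_of_isCentreFor`).
The maximality of this element over ALL of `W(f)` beyond the first block (Hironaka's vertex theorem
after preparation, [CJS20, Thm. 8.16]) is NOT claimed.
-/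

noncomputable section

open MvPolynomial

namespace Literature.AlgebraicGeometry.Resolution

namespace WeightedBlowup

variable {k : Type*} [Field k] {n : ℕ}

/-! ## §1 Centres of shape `(Ψ; y^ν, u^{νc})` -/

/-- **`(Ψ; y^ν, u^{νc})` is a centre for `f` iff `Ψ` fixes the origin and `c ≤ δ(Ψ⁻¹ f; u; y)`**
(`ν, c > 0`; `S` = the `y`-variables).
[cite: CossartJannsenSaito2020, Def. 8.1 (3) and Def. 8.2 (1) (pp. 117–118)];
[cite: AbramovichTemkinWlodarczyk2024, Def. 2.4.1 (2) and Rem. 2.4.2 (p. 1568)] -/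
theorem isCentreFor_blockWeights_iff (f : MvPolynomial (Fin n) k)
    (Ψ : MvPolynomial (Fin n) k ≃ₐ[k] MvPolynomial (Fin n) k) (S : Finset (Fin n)) {ν : ℕ}
    (hν : 0 < ν) {c : ℚ} (hc : 0 < c) :
    IsCentreFor f Ψ (blockWeights S ν c) ↔
      (∀ i, constantCoeff (Ψ (X i)) = 0) ∧ (c : WithTop ℚ) ≤ hironakaDelta S ν (Ψ.symm f) := by
  unfold IsCentreFor
  rw [isAdmissibleFor_blockWeights_iff_le_delta S hν hc]
  exact ⟨fun h => ⟨h.1, h.2.2⟩, fun h => ⟨h.1, fun i => blockWeights_nonneg S ν hc.le i, h.2⟩⟩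

/-- No centre of shape `(Ψ; y^ν, u^{νc})` with `c > δ(Ψ⁻¹ f; u; y)`.
[cite: CossartJannsenSaito2020, Def. 8.1 (3) and Def. 8.2 (1) (pp. 117–118)];
[cite: AbramovichTemkinWlodarczyk2024, Def. 2.4.1 (2) (p. 1568)] -/
theorem not_isCentreFor_blockWeights_of_delta_lt (f : MvPolynomial (Fin n) k)
    (Ψ : MvPolynomial (Fin n) k ≃ₐ[k] MvPolynomial (Fin n) k) (S : Finset (Fin n)) {ν : ℕ}
    (hν : 0 < ν) {c : ℚ} (hc : 0 < c) (hlt : hironakaDelta S ν (Ψ.symm f) < (c : WithTop ℚ)) :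
    ¬ IsCentreFor f Ψ (blockWeights S ν c) := by
  rw [isCentreFor_blockWeights_iff f Ψ S hν hc]
  exact fun h => (not_le.mpr hlt) h.2

/-- **The exponent list of `(y^ν, u^{νc})`, `c ≥ 1`: `|S|` entries `ν` followed by `n − |S|` entries
`νc`.** [cite: AbramovichTemkinWlodarczyk2024, §5.1 (p. 1575) (J = (x₁^{a₁}, …, x_k^{a_k}),
a₁ ≤ ⋯ ≤ a_k)] -/
theorem exps_blockWeights (S : Finset (Fin n)) {ν : ℕ} (hν : 0 < ν) {c : ℚ} (hc : 1 ≤ c) :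
    exps (blockWeights S ν c) =
      List.replicate S.card (ν : ℚ) ++ List.replicate (n - S.card) ((ν : ℚ) * c) := by
  classical
  have hν' : (0 : ℚ) < ν := by exact_mod_cast hν
  have hνc : (0 : ℚ) < (ν : ℚ) * c := mul_pos hν' (lt_of_lt_of_le one_pos hc)
  have hle : (ν : ℚ) ≤ (ν : ℚ) * c := le_mul_of_one_le_right hν'.le hc
  -- the weights are all nonzero, with inverses `ν` on `S` and `ν c` off `S`
  have hne : ∀ i, blockWeights S ν c i ≠ 0 := by
    intro i
    unfold blockWeights
    split_ifs
    · exact inv_ne_zero hν'.ne'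
    · exact inv_ne_zero hνc.ne'
  have hinv : ∀ i, (blockWeights S ν c i)⁻¹ = if i ∈ S then (ν : ℚ) else (ν : ℚ) * c := by
    intro i
    unfold blockWeights
    split_ifs <;> exact inv_inv _
  -- both sides are sorted, so it suffices that they are permutations of each other
  have hperm : (exps (blockWeights S ν c)).Perm
      (List.replicate S.card (ν : ℚ) ++ List.replicate (n - S.card) ((ν : ℚ) * c)) := by
    unfold exps
    refine (List.perm_insertionSort _ _).trans ?_
    rw [← Multiset.coe_eq_coe, ← Multiset.map_coe, Finset.coe_toList, Finset.filter_true_of_mem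
      (fun i _ => hne i), ← Multiset.coe_add, Multiset.coe_replicate, Multiset.coe_replicate]
    have hsplit : (Finset.univ : Finset (Fin n)).val =
        (Finset.univ.filter (· ∈ S)).val + (Finset.univ.filter (· ∉ S)).val := by
      rw [Finset.filter_val, Finset.filter_val]
      exact (Multiset.filter_add_not _ _).symm
    rw [hsplit, Multiset.map_add]
    have h1 : Multiset.map (fun i => (blockWeights S ν c i)⁻¹) (Finset.univ.filter (· ∈ S)).val =
        Multiset.replicate S.card (ν : ℚ) := by
      rw [Finset.filter_mem_eq_inter, Finset.univ_inter, ← Finset.card_val, ← Multiset.map_const']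
      refine Multiset.map_congr rfl fun i hi => ?_
      rw [hinv i, if_pos (Finset.mem_val.mp hi)]
    have h2 : Multiset.map (fun i => (blockWeights S ν c i)⁻¹) (Finset.univ.filter (· ∉ S)).val =
        Multiset.replicate (n - S.card) ((ν : ℚ) * c) := by
      have hSc : (Finset.univ.filter fun i : Fin n => i ∉ S) = Sᶜ := by
        rw [Finset.filter_not, Finset.filter_mem_eq_inter, Finset.univ_inter,
          Finset.compl_eq_univ_sdiff]
      have hcard : Sᶜ.card = n - S.card := by
        rw [Finset.card_compl, Fintype.card_fin]
      rw [hSc, ← hcard, ← Finset.card_val, ← Multiset.map_const']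
      refine Multiset.map_congr rfl fun i hi => ?_
      have hi' : i ∉ S := Finset.mem_compl.mp (Finset.mem_val.mp hi)
      rw [hinv i, if_neg hi']
    rw [h1, h2]
  have hsorted : (List.replicate S.card (ν : ℚ) ++
      List.replicate (n - S.card) ((ν : ℚ) * c)).Pairwise (· ≤ ·) := by
    rw [List.pairwise_append]
    refine ⟨List.pairwise_replicate.mpr (Or.inr le_rfl), List.pairwise_replicate.mpr (Or.inr le_rfl),
      fun x hx y hy => ?_⟩
    rw [List.eq_of_mem_replicate hx, List.eq_of_mem_replicate hy]
    exact hle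
  exact hperm.eq_of_sortedLE (exps_sorted _).sortedLE hsorted.sortedLE

/-! ## §2 The first-stage element of `W(f)` -/

/-- **`δ(Ψ⁻¹ f; u; y) ≥ 1` for `ν = ord f`** and `Ψ` fixing the origin: every monomial of `Ψ⁻¹ f` has
degree `≥ ν` (rigidity `ord(Ψ⁻¹ f) = ord f`).
[cite: CossartJannsenSaito2020, Def. 8.2 (1) (pp. 117–118)];
[cite: AbramovichTemkinWlodarczyk2024, Lemma 5.2.10 (p. 1577)] -/
theorem one_le_hironakaDelta_symm {f : MvPolynomial (Fin n) k} {ν : ℕ}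
    (hν : monomialOrd (fun _ => 1) f = ν) (Ψ : MvPolynomial (Fin n) k ≃ₐ[k] MvPolynomial (Fin n) k)
    (hΨ : ∀ i, constantCoeff (Ψ (X i)) = 0) (S : Finset (Fin n)) :
    (1 : WithTop ℚ) ≤ hironakaDelta S ν (Ψ.symm f) := by
  refine one_le_hironakaDelta S ν (Ψ.symm f) ((le_monomialOrd_one_iff (Ψ.symm f) ν).mp ?_)
  rw [monomialOrd_one_symm_eq Ψ hΨ f, hν]

/-- **`(ν^{|S|}, (νc)^{n−|S|}) ∈ W(f)` for every `1 ≤ c ≤ δ(Ψ⁻¹ f; u; y)`** (`Ψ` fixing the origin).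
[cite: AbramovichTemkinWlodarczyk2024, Def. 2.4.1 and §5.1 (pp. 1568, 1575)];
[cite: CossartJannsenSaito2020, Def. 8.1 (3) and Def. 8.2 (1) (pp. 117–118)] -/
theorem blockShape_mem_admissibleInvariants (f : MvPolynomial (Fin n) k)
    (Ψ : MvPolynomial (Fin n) k ≃ₐ[k] MvPolynomial (Fin n) k) (hΨ : ∀ i, constantCoeff (Ψ (X i)) = 0)
    (S : Finset (Fin n)) {ν : ℕ} (hν : 0 < ν) {c : ℚ} (hc1 : 1 ≤ c)
    (hc : (c : WithTop ℚ) ≤ hironakaDelta S ν (Ψ.symm f)) :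
    List.replicate S.card (ν : ℚ) ++ List.replicate (n - S.card) ((ν : ℚ) * c) ∈
      admissibleInvariants f := by
  rw [← exps_blockWeights S hν hc1]
  exact exps_mem_admissibleInvariants
    ((isCentreFor_blockWeights_iff f Ψ S hν (lt_of_lt_of_le one_pos hc1)).mpr ⟨hΨ, hc⟩)

/-- **The first-stage centre: `(ν^{|S|}, (νδ)^{n−|S|}) ∈ W(f)`** for `ν = ord f`, `Ψ` fixing the
origin and `δ = δ(Ψ⁻¹ f; u; y) < ∞` (then `δ ≥ 1` automatically).
[cite: AbramovichTemkinWlodarczyk2024, Def. 2.4.1 and §5.1 (pp. 1568, 1575)];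
[cite: CossartJannsenSaito2020, Def. 8.1 (3) and Def. 8.2 (1) (pp. 117–118)] -/
theorem firstStage_mem_admissibleInvariants {f : MvPolynomial (Fin n) k} {ν : ℕ}
    (hord : monomialOrd (fun _ => 1) f = ν) (hν : 0 < ν)
    (Ψ : MvPolynomial (Fin n) k ≃ₐ[k] MvPolynomial (Fin n) k) (hΨ : ∀ i, constantCoeff (Ψ (X i)) = 0)
    (S : Finset (Fin n)) {δ : ℚ} (hδ : hironakaDelta S ν (Ψ.symm f) = (δ : WithTop ℚ)) :
    List.replicate S.card (ν : ℚ) ++ List.replicate (n - S.card) ((ν : ℚ) * δ) ∈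
      admissibleInvariants f := by
  have h1 : (1 : ℚ) ≤ δ := by
    have := one_le_hironakaDelta_symm hord Ψ hΨ S
    rw [hδ, ← WithTop.coe_one, WithTop.coe_le_coe] at this
    exact this
  exact blockShape_mem_admissibleInvariants f Ψ hΨ S hν h1 (by rw [hδ])

/-! ## §3 These elements increase with `c` in ATW's order -/

/-- Common prefixes cancel in ATW's order. [folklore] -/
private theorem truncLex_append_left_iff (l a b : List ℚ) :
    ATW.TruncLex.lt (l ++ a) (l ++ b) ↔ ATW.TruncLex.lt a b := by
  induction l with
  | nil => simp
  | cons x xs ih =>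
    rw [List.cons_append, List.cons_append, ATW.TruncLex.cons_lt_cons, ih]
    exact ⟨fun h => h.elim (fun h => absurd h (lt_irrefl x)) fun h => h.2, fun h => Or.inr ⟨rfl, h⟩⟩

/-- **`(ν^{|S|}, (νc)^{m}) < (ν^{|S|}, (νc')^{m})` for `c < c'`** (`m = n − |S| > 0`, `ν > 0`): among the
centres of shape `(Ψ; y^ν, u^{νc})` the invariant increases with `c`, so `c = δ` gives the largest.
[cite: AbramovichTemkinWlodarczyk2024, §5.1 (p. 1575) (order of invariants)] -/
theorem truncLex_blockShape_lt (S : Finset (Fin n)) {ν : ℕ} (hν : 0 < ν) {c c' : ℚ} (hcc' : c < c')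
    (hS : S.card < n) :
    ATW.TruncLex.lt (List.replicate S.card (ν : ℚ) ++ List.replicate (n - S.card) ((ν : ℚ) * c))
      (List.replicate S.card (ν : ℚ) ++ List.replicate (n - S.card) ((ν : ℚ) * c')) := by
  rw [truncLex_append_left_iff]
  obtain ⟨m, hm⟩ := Nat.exists_eq_succ_of_ne_zero (Nat.sub_ne_zero_of_lt hS)
  rw [hm, List.replicate_succ, List.replicate_succ, ATW.TruncLex.cons_lt_cons]
  have hν' : (0 : ℚ) < ν := by exact_mod_cast hν
  exact Or.inl (mul_lt_mul_of_pos_left hcc' hν')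

/-! ## §4 The `y`-block of such a centre and the directrix -/

/-- For `c ≥ 1` all weights of `(y^ν, u^{νc})` are `≤ 1/ν`. [folklore] -/
private theorem blockWeights_le_inv (S : Finset (Fin n)) {ν : ℕ} (hν : 0 < ν) {c : ℚ} (hc : 1 ≤ c)
    (i : Fin n) : blockWeights S ν c i ≤ (ν : ℚ)⁻¹ := by
  have hν' : (0 : ℚ) < ν := by exact_mod_cast hν
  unfold blockWeights
  split_ifs
  · exact le_rfl
  · rw [mul_inv]
    exact mul_le_of_le_one_right (inv_nonneg.mpr hν'.le) (inv_le_one_of_one_le₀ hc)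

/-- For `c > 1` the weight `1/ν` is taken exactly on `S`. [folklore] -/
private theorem filter_blockWeights_eq_inv (S : Finset (Fin n)) {ν : ℕ} (hν : 0 < ν) {c : ℚ}
    (hc : 1 < c) : (Finset.univ.filter fun i => blockWeights S ν c i = (ν : ℚ)⁻¹) = S := by
  have hν' : (0 : ℚ) < ν := by exact_mod_cast hν
  ext i
  rw [Finset.mem_filter]
  unfold blockWeights
  split_ifs with hi
  · exact ⟨fun _ => hi, fun h => ⟨Finset.mem_univ i, rfl⟩⟩
  · refine ⟨fun h => absurd (inv_injective h.2) ?_, fun h => absurd h hi⟩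
    exact ne_of_gt (lt_mul_of_one_lt_right hν' hc)

/-- For `c > 1` the index set `{i | weight = 1/ν}` is `S`. [folklore] -/
private theorem setOf_blockWeights_eq_inv (S : Finset (Fin n)) {ν : ℕ} (hν : 0 < ν) {c : ℚ}
    (hc : 1 < c) : {i | blockWeights S ν c i = (ν : ℚ)⁻¹} = (S : Set (Fin n)) := by
  ext i
  have := congrArg (i ∈ ·) (filter_blockWeights_eq_inv S hν hc)
  simp only [Finset.mem_filter, Finset.mem_univ, true_and, eq_iff_iff] at this
  exact this

/-- **A centre `(Ψ; y^ν, u^{νc})` with `c > 1` for `f` (`ν = ord f`) has at least `τ(in_ν f)`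
`y`-variables: `τ ≤ |S|`** (Thm 4.0 block 0 of the certificate, specialised to this shape).
[cite: AbramovichTemkinWlodarczyk2024, §5.1 (p. 1575) and Thm. 5.3.1 (2) (p. 1578)];
[cite: CossartPiltant2008, proof of Prop. 4.2] -/
theorem hironakaTau_le_card_of_isCentreFor_blockWeights {f : MvPolynomial (Fin n) k} {ν : ℕ}
    (hord : monomialOrd (fun _ => 1) f = ν) (hν : 0 < ν)
    {Ψ : MvPolynomial (Fin n) k ≃ₐ[k] MvPolynomial (Fin n) k} {S : Finset (Fin n)} {c : ℚ} (hc : 1 < c)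
    (h : IsCentreFor f Ψ (blockWeights S ν c)) :
    hironakaTau k {homogeneousComponent ν f} ≤ S.card := by
  have := hironakaTau_le_card_inv_nu hord h (blockWeights_le_inv S hν hc.le)
  rwa [filter_blockWeights_eq_inv S hν hc] at this

/-- **… and with exactly `τ` `y`-variables their linear parts cut out the directrix**:
`Dir(in_ν f) = V(in_1 Ψ(x_i) : i ∈ S)` (as the annihilator of the span of these linear forms).
[cite: AbramovichTemkinWlodarczyk2024, Thm. 5.3.1 (2) and its proof (p. 1578)];
[cite: CossartPiltant2008, proof of Prop. 4.2] -/
theorem directrix_eq_span_of_isCentreFor_blockWeights {f : MvPolynomial (Fin n) k} {ν : ℕ}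
    (hord : monomialOrd (fun _ => 1) f = ν) (hν : 0 < ν)
    {Ψ : MvPolynomial (Fin n) k ≃ₐ[k] MvPolynomial (Fin n) k} {S : Finset (Fin n)} {c : ℚ} (hc : 1 < c)
    (h : IsCentreFor f Ψ (blockWeights S ν c))
    (hτ : S.card ≤ hironakaTau k {homogeneousComponent ν f}) :
    directrix k {homogeneousComponent ν f} =
      (Submodule.span k ((fun i => homogeneousComponent 1 (Ψ (X i))) '' (S : Set (Fin n)))).comap
        (linearFormPolyₗ k) := by
  have hτ' : (Finset.univ.filter fun i => blockWeights S ν c i = (ν : ℚ)⁻¹).card ≤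
      hironakaTau k {homogeneousComponent ν f} := by
    rwa [filter_blockWeights_eq_inv S hν hc]
  rw [directrix_eq_span_of_isCentreFor hord h (blockWeights_le_inv S hν hc.le) hτ',
    setOf_blockWeights_eq_inv S hν hc]

end WeightedBlowup

end Literature.AlgebraicGeometry.Resolution

end
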